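import Literature.MathematicalPhysics.QuantumFieldTheory.Balaban1983to89.B9Eq346AgmonReadingZd
import Literature.MathematicalPhysics.QuantumFieldTheory.Balaban1983to89.B9Eq323ConjugatedLaplacianFormZd
import Literature.MathematicalPhysics.QuantumFieldTheory.Balaban1983to89.B9Eq324ConjugatedFormZd

/-!
# `Balaban1983to89.B9Thm31GpAgmonDecayZd` — [Balaban1985BackgroundPropagators] Thm 3.1 (3.42) p. 397 ∕ (3.46) p. 398 FOR THE GENUINE `G′(U₀) = (Ω₀Δ′_a(U₀)Ω₀)⁻¹`
# OF (3.24) AT THE `ℤᵈ` CARRIER, BY S. AGMON'S POSITIVE-WEIGHT METHOD: from a DISPLAYED level-weighted coercivity `c₀Σ_z M_z|Φ(z)|²_τ ≤ ⟨Φ, Δ′_aΦ⟩_τ` and a weight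
# `ω > 0` whose bond ratios and block oscillations are dominated by the masses (`J_b + J_s ≤ θc₀M`, `0 ≤ θ < 1`),
# ★★★ `|(G′(U₀)δ_y w)(x)|_τ ≤ |w|_τ ∕ ((1−θ)c₀·√(M_xM_y)·ω(x))` (`ω(y) = 1`) and the `L²`-local `Σ_{Ω₀∩A}|(G′Ψ)(x)|²_τ ≤ ‖Ψ‖²_τ∕(((1−θ)c₀)²M_AM_BW²)`;
# with `ω = e^{κρ}`: `|(G′(U₀)δ_y w)(x)|_τ ≤ e^{−κ(ρ(x) − ρ(y))}·|w|_τ ∕ ((1−θ)c₀√(M_xM_y))` under the window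
# `6dη⁻²(cosh κℓ − 1) + Σ_{j≤m} 𝟙[yʲ(z)∈Λ_j]·a_j(e^{2κσ_j} − 1)(Lᵈ)^{−j} ≤ θc₀M(z)` — NO `|Ω₀|`, and NO `η` when `M`, `ℓ`, `σ` carry print's scaling

statement-level skeleton of published theorems with citation tags; proofs where landed; nothing here is a claim about the
Yang–Mills mass gap

`[Balaban1985BackgroundPropagators]` ("B9", CMP **99** (1985) 389–434): Thm 3.1 p. 397 *«G′(U) … satisfies |(G′(U)f)(x)| ≤ O(1)(Lʲη)²e^{−δ₀d(y,y′)}|f| (3.42) …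
uniformly in U, Ω_j»*; (3.46) p. 398 *«‖hG′(U)λ‖ … ≦ B₀(Lʲη)(Lʲ′η)e^{−δ₀d(y,y′)}‖h‖‖λ‖»*; (3.24) p. 394; Thm 3.11 p. 416.  Print proves these by the random walk of
Sects. B–C.  THE ROUTE'S SUBSTITUTE HERE is S. Agmon's positive-weight method [Agmon1982] in the form dag-n06-w1 g2 used member-uniformly at def-Y's record carrier
(`B9Thm31SiteGpDecayReg335Y`, `B₀ = 16`), now at the `ℤᵈ` junction frame: FILE 1 `B9Eq346AgmonReadingZd` (the readings), FILE 2a∕2b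
`B9Eq323ConjugatedLaplacianFormZd` ∕ `B9Eq324ConjugatedFormZd` (the conjugated form of the genuine `Ω₀Δ′_a(U₀)Ω₀` ≥ form − defect, the defect SECOND order in the
bond ratios of `ω` and first order in its block oscillations) — and this file reads them against a DISPLAYED level-weighted coercivity.  WHAT IT BUYS over
this seat's g4 Schur-window files (`B9Thm31GpDecayOfCoerciveZd`, `…PlaqClosedZd`): the constants of the conclusion are `(1−θ)c₀`, the masses `M` and the weight
`ω` — NOTHING ELSE (no `|Ω₀|`, no matrix-entry window `(4d∕η² + Σa_j)(2Lᵐ+1)ᵈ(e^{κLᵐ} − 1) < c`); with print's scaling `M_z = m₀(L^{j(z)}η)⁻²`, `a_j(Lᵈ)^{−j} ≈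
a(Lʲη)⁻²`, and a weight of slope `κL^{−j}` per fine bond and bounded block oscillation, the window below is a condition on `κ` in terms of `(m₀∕c₀, a∕c₀, d, θ)`
alone — uniform in the lattice spacing and the member, which is what print's «uniformly in U, Ω_j» asks and what g4's ■ CLOSE named as THE GAP LEFT.

CITATION HEADER (lean-in-tree rule).  Cell `pub-ymgap` (YM Track A, HUMAN RULING D-0062 ∕ D-0149 width push), DAG node N06 = [B9], width seat
`pub-ymgap-dag-n06-w2` (g5), CLAIM-3 («Agmon ∕ form-relative edition of the Combes–Thomas road at the ℤᵈ frame», FILE 3 = assembly).  Inputs BY NAME: `GpZd ∕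
deltaPrimeADom ∕ deltaPrimeADom_GpZd` (dag-n06-w4 g2), FILE 1's `fnorm_inv_single_le_of_conj_coercive ∕ sq_sum_le_of_conj_coercive ∕ conj_coercive_of_defect`, FILE 2a's
`bondRatio ∕ sum_finsum_conj_covDerivFwd_ge`, FILE 2b's `sum_conj_QprimeIter_ge`, dag-n06-w4 g2's `formE_deltaPrimeADom` (polarized form identity).  The DISPLAYED coercivity is dag-n06-w4's lane (`B9Thm31FlatPoincareCoerciveZd` at
`U₀ = 1`, g5 CLAIM-5; the curved class to follow) — consumed as a hypothesis, never restated.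

WHAT IS PROVED (kernel, 0 sorry, 0 def; no `instance`, no `notation`).
* §1 ★★★ `formE_conj_deltaPrimeADom_ge` — THE CONJUGATED FORM OF THE GENUINE `Ω₀Δ′_a(U₀)Ω₀`: `⟨Φ, Δ′_aΦ⟩_τ − Σ_{z∈Ω₀}(J_b(z) + J_s(z))|Φ(z)|²_τ ≤ ⟨ωΦ, Δ′_a(ω⁻¹Φ)⟩_τ`
  (FILE 2a's gradient defect `J_b`, FILE 2b's averaging defect `J_s`, assembled through `formE_deltaPrimeADom`); ★★★ `formE_conj_deltaPrimeADom_ge_of_masses` — THE MASS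
  FORM: `J_b + J_s ≤ θc₀M` on `Ω₀` ⟹ `⟨Φ, Δ′_aΦ⟩_τ − θ(c₀Σ_zM_z|Φ z|²_τ) ≤ ⟨ωΦ, Δ′_a(ω⁻¹Φ)⟩_τ` (the `hdef` slot of FILE 1's `conj_coercive_of_defect` VERBATIM).
* §2 ★★★ `fnorm_GpZd_single_le_of_levelCoercive` — THE POINTWISE (3.42)-SHAPE BOUND for `G′(U₀)`: unitary `U₀` with unitary averaged transporters below `m`,
  `a ≥ 0`, `0 < d`, `η ≠ 0`, `L ≥ 1`, tracial Hermitian faithful `τ`; DISPLAYED `hco : c₀Σ_{z∈Ω₀}M_z|Φ z|²_τ ≤ ⟨Φ, Ω₀Δ′_a(U₀)Ω₀Φ⟩_τ` (`c₀ > 0`, `M ≥ 0`); a weight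
  `ω > 0` with block data `(ω̂_j, ε_j, ε′_j)` and `J_b + J_s ≤ θc₀M` on `Ω₀` (`0 ≤ θ < 1`); THEN for `y ∈ Ω₀`, `ω(y) = 1`, `M_x, M_y > 0`:
  `|(G′(U₀)δ_y w)(x)|_τ ≤ |w|_τ ∕ ((1−θ)c₀·√(M_xM_y)·ω(x))`.
* §2 ★★ `sq_sum_GpZd_le_of_levelCoercive` — THE `L²`-LOCAL (3.46a)-SHAPE BOUND: `Ψ` supported in `B`, `ω = 1` on `B`, `ω ≥ W > 0` and `M ≥ M_A > 0` on `A`,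
  `M ≥ M_B > 0` on `B` ⟹ `Σ_{Ω₀∩A}|(G′(U₀)Ψ)(x)|²_τ ≤ ‖Ψ‖²_τ ∕ (((1−θ)c₀)²·M_A·M_B·W²)`.
* §3 exponential weights: `bondRatio_exp_le` (`r_{e^{κρ}}(x,μ) = 2(cosh(κΔρ) − 1) ≤ 2(cosh κℓ − 1)` for `|Δρ| ≤ ℓ`), `abs_exp_div_exp_sub_one_le`
  (`|e^{κρ}∕e^{κρ̂} − 1| ≤ e^{κσ} − 1` for `|ρ − ρ̂| ≤ σ`), `two_eps_le` (`2δ + δ² = e^{2κσ} − 1` at `δ = e^{κσ} − 1`), and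
  ★★★ `fnorm_GpZd_single_le_exp_of_levelCoercive` — with `ω = e^{κ(ρ − ρ(y))}`, `ρ` of bond increments `≤ ℓ` and level-`j` block radii `≤ σ_j` about references
  `ρ̂_j(y)`, under the WINDOW `∀ z ∈ Ω₀, 6dη⁻²(cosh κℓ − 1) + Σ_{j≤m}𝟙[yʲ(z)∈Λ_j]a_j(e^{2κσ_j} − 1)(Lᵈ)^{−j} ≤ θc₀M(z)`:
  `|(G′(U₀)δ_y w)(x)|_τ ≤ e^{−κ(ρ(x) − ρ(y))}·|w|_τ ∕ ((1−θ)c₀·√(M_xM_y))`.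

HONEST SCOPE.  (i) A REDUCTION: the level-weighted coercivity `hco` is DISPLAYED, not proved here (print: Thm 3.11 ∕ Sect. B; at the frame dag-n06-w4's lane); the
identification of print's weighted block distance `d(y,y′)` with an admissible `ρ` over the cube geometry of (1.131) (slope `L^{−j}` across level-`j` bonds,
bounded oscillation on blocks) is a geometric lemma NOT made here (cf. dag-n06-j's `B6AgmonExponentMultiLevelTorus.msRhoT` at the record).  (ii) The sup-norm ∕ Hölder
entries (3.43)–(3.45), the derivative companions, (3.47) are untouched.  (iii) What is uniform: GIVEN `hco` with masses of print's scaling, every constant in the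
conclusions is free of `η`, `|Ω₀|`, `U₀`; nothing else is claimed.  Count-neutral; N05 ∕ N06 NOT discharged; K1⁹ `stmt-QuantumFields-27364` NOT closed; one finite
`𝕋⁴` programme at fixed `ε`, Bałaban as printed; R4 closes only the conditional finite-`𝕋⁴` rung `BalabanLadder.UV` — nothing continuum ∕ ℝ⁴ ∕ OS ∕ mass gap ∕
Clay.  Unit `pub-ymgap-dag-n06-w2` (g5), 2026-08-28.
-/

noncomputable section

open scoped BigOperators

namespace Literature.MathematicalPhysics.QuantumFieldTheory.Balaban1983to89.B9Thm31GpAgmonDecayZd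

open B7Prop1Explicit (e)
open B7Prop2Explicit (unitaryUnits)
open B8Eq119TwistedAxial (bgT)
open B9Eq321LandauProjectionZd (suppSub formE formE_apply)
open B9Eq324DeltaPrimeAZd (single restrictSite deltaPrimeADom GpZd deltaPrimeADom_GpZd formE_deltaPrimeADom)
open B9Eq325QprimeSingleSiteZd (blockMapIter)
open B9Eq342CombesThomasFormZd
open B9Eq346AgmonReadingZd (fnorm_inv_single_le_of_conj_coercive sq_sum_le_of_conj_coercive conj_coercive_of_defect)
open B9Eq323ConjugatedLaplacianFormZd (bondRatio bondRatio_def sum_finsum_conj_covDerivFwd_ge)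
open B9Eq324ConjugatedFormZd (sum_conj_QprimeIter_ge)

export B7Prop1Explicit (Site)

variable {d : ℕ} {𝔸 : Type*} [CStarAlgebra 𝔸]

/-! ## §1  The conjugated form of `Ω₀Δ′_a(U₀)Ω₀` -/

section Assembly

variable {L : ℕ} {U₀ : Site d → Fin d → 𝔸ˣ} {η : ℝ} (τ : 𝔸 →ₗ[ℂ] ℂ) {s : Finset (Site d)} [FiniteDimensional ℝ 𝔸]
  (hτp : ∀ a : 𝔸, a ≠ 0 → 0 < (τ (star a * a)).re) {m : ℕ} {a : ℕ → ℝ} {Λ : ℕ → Finset (Site d)}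

/-- ★★★ **THE CONJUGATED FORM OF THE GENUINE `Ω₀Δ′_a(U₀)Ω₀`.**  `L ≥ 1`; `U₀` unitary with unitary averaged transporters below level `m`; tracial Hermitian faithful `τ`;
`a_j ≥ 0`; a site weight `ω > 0` with per-level block data `(ω̂_j, ε_j, ε′_j)` as in `sum_conj_QprimeIter_ge`.  THEN for every `Φ ∈ L²(Ω₀, ·)`:
`⟨Φ, Δ′_aΦ⟩_τ − Σ_{z∈Ω₀} (J_b(z) + J_s(z))·|Φ(z)|²_τ ≤ ⟨ωΦ, Δ′_a(ω⁻¹Φ)⟩_τ`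
(`J_b` of `B9Eq323ConjugatedLaplacianFormZd.sum_finsum_conj_covDerivFwd_ge`, `J_s` of §3) — the form is conjugation-stable up to a defect SECOND order in the bond
ratios of `ω` and FIRST order in its block oscillations.
[cite: Balaban1985BackgroundPropagators, (3.23)–(3.24) p.394, Thm 3.1 (3.42) p.397, (3.46) p.398; Agmon1982, Thm 1.5 p.19] -/
theorem formE_conj_deltaPrimeADom_ge [NeZero L] (hτt : ∀ a b : 𝔸, τ (a * b) = τ (b * a)) (hτs : ∀ a : 𝔸, τ (star a) = starRingEnd ℂ (τ a))
    (hU : ∀ (x : Site d) (κ : Fin d), U₀ x κ ∈ unitaryUnits 𝔸) (hT : ∀ j', j' < m → ∀ z y : Site d, bgT L U₀ j' z y ∈ unitaryUnits 𝔸)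
    (ha : ∀ j, 0 ≤ a j) {ω : Site d → ℝ} (hω : ∀ z, 0 < ω z)
    {wref : ℕ → Site d → ℝ} (hwref : ∀ j y, 0 < wref j y) {ε ε' : ℕ → ℝ} (hε : ∀ j, 0 ≤ ε j) (hε' : ∀ j, 0 ≤ ε' j)
    (hosc : ∀ j ∈ Finset.range (m + 1), ∀ y ∈ Λ j, ∀ x ∈ s, blockMapIter L j x = y →
      |ω x / wref j y - 1| ≤ ε j ∧ |wref j y / ω x - 1| ≤ ε' j)
    (Φ : suppSub (𝔸 := 𝔸) s) :
    formE τ s Φ (deltaPrimeADom L U₀ η τ hτp m a Λ s Φ) -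
        ∑ z ∈ s, (((η⁻¹) ^ 2 * ∑ μ : Fin d, (5 / 2 * bondRatio ω (z - e μ) μ + 1 / 2 * bondRatio ω z μ)) +
          ∑ j ∈ Finset.range (m + 1),
            (if blockMapIter L j z ∈ Λ j then a j * (ε j + ε' j + ε j * ε' j) * (((L : ℝ) ^ d)⁻¹) ^ j else 0)) * fnorm τ ((Φ : Site d → 𝔸) z) ^ 2 ≤
      formE τ s (scaleFn s ω Φ) (deltaPrimeADom L U₀ η τ hτp m a Λ s (scaleFn s (fun z => (ω z)⁻¹) Φ)) := by
  rw [formE_deltaPrimeADom τ hτp hτt hτs hU Φ Φ, formE_deltaPrimeADom τ hτp hτt hτs hU (scaleFn s (fun z => (ω z)⁻¹) Φ) (scaleFn s ω Φ)]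
  have hcoe₁ : ((scaleFn s ω Φ : suppSub (𝔸 := 𝔸) s) : Site d → 𝔸) = fun z => ω z • (Φ : Site d → 𝔸) z := rfl
  have hcoe₂ : ((scaleFn s (fun z => (ω z)⁻¹) Φ : suppSub (𝔸 := 𝔸) s) : Site d → 𝔸) = fun z => (ω z)⁻¹ • (Φ : Site d → 𝔸) z := rfl
  rw [hcoe₁, hcoe₂]
  have hD := sum_finsum_conj_covDerivFwd_ge τ hτp hτt hτs hU hω Φ (η := η)
  have hQ := sum_conj_QprimeIter_ge τ hτp hτt hτs hT ha Λ hω hwref hε hε' hosc Φ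
  have hsplit : ∑ z ∈ s, (((η⁻¹) ^ 2 * ∑ μ : Fin d, (5 / 2 * bondRatio ω (z - e μ) μ + 1 / 2 * bondRatio ω z μ)) +
      ∑ j ∈ Finset.range (m + 1),
        (if blockMapIter L j z ∈ Λ j then a j * (ε j + ε' j + ε j * ε' j) * (((L : ℝ) ^ d)⁻¹) ^ j else 0)) * fnorm τ ((Φ : Site d → 𝔸) z) ^ 2 =
      (∑ z ∈ s, ((η⁻¹) ^ 2 * ∑ μ : Fin d, (5 / 2 * bondRatio ω (z - e μ) μ + 1 / 2 * bondRatio ω z μ)) * fnorm τ ((Φ : Site d → 𝔸) z) ^ 2) +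
        ∑ z ∈ s, (∑ j ∈ Finset.range (m + 1),
          (if blockMapIter L j z ∈ Λ j then a j * (ε j + ε' j + ε j * ε' j) * (((L : ℝ) ^ d)⁻¹) ^ j else 0)) * fnorm τ ((Φ : Site d → 𝔸) z) ^ 2 := by
    rw [← Finset.sum_add_distrib]
    exact Finset.sum_congr rfl fun z _ => add_mul _ _ _
  rw [hsplit]
  linarith

/-- ★★★ **THE MASS FORM** — the `hdef` slot of `B9Eq346AgmonReadingZd.conj_coercive_of_defect` VERBATIM: if the total defect is dominated by level masses,
`J_b(z) + J_s(z) ≤ θ·c₀·M(z)` on `Ω₀`, then `⟨Φ, Δ′_aΦ⟩_τ − θ·(c₀·Σ_{z∈Ω₀} M(z)|Φ(z)|²_τ) ≤ ⟨ωΦ, Δ′_a(ω⁻¹Φ)⟩_τ` for every `Φ ∈ L²(Ω₀, ·)`.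
[cite: Balaban1985BackgroundPropagators, (3.24) p.394, Thm 3.1 (3.42) p.397, (3.46) p.398; Agmon1982, Thm 1.5 p.19] -/
theorem formE_conj_deltaPrimeADom_ge_of_masses [NeZero L] (hτt : ∀ a b : 𝔸, τ (a * b) = τ (b * a)) (hτs : ∀ a : 𝔸, τ (star a) = starRingEnd ℂ (τ a))
    (hU : ∀ (x : Site d) (κ : Fin d), U₀ x κ ∈ unitaryUnits 𝔸) (hT : ∀ j', j' < m → ∀ z y : Site d, bgT L U₀ j' z y ∈ unitaryUnits 𝔸)
    (ha : ∀ j, 0 ≤ a j) {ω : Site d → ℝ} (hω : ∀ z, 0 < ω z)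
    {wref : ℕ → Site d → ℝ} (hwref : ∀ j y, 0 < wref j y) {ε ε' : ℕ → ℝ} (hε : ∀ j, 0 ≤ ε j) (hε' : ∀ j, 0 ≤ ε' j)
    (hosc : ∀ j ∈ Finset.range (m + 1), ∀ y ∈ Λ j, ∀ x ∈ s, blockMapIter L j x = y →
      |ω x / wref j y - 1| ≤ ε j ∧ |wref j y / ω x - 1| ≤ ε' j)
    {θ c₀ : ℝ} {M : Site d → ℝ}
    (hJ : ∀ z ∈ s, ((η⁻¹) ^ 2 * ∑ μ : Fin d, (5 / 2 * bondRatio ω (z - e μ) μ + 1 / 2 * bondRatio ω z μ)) +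
      ∑ j ∈ Finset.range (m + 1),
        (if blockMapIter L j z ∈ Λ j then a j * (ε j + ε' j + ε j * ε' j) * (((L : ℝ) ^ d)⁻¹) ^ j else 0) ≤ θ * c₀ * M z)
    (Φ : suppSub (𝔸 := 𝔸) s) :
    formE τ s Φ (deltaPrimeADom L U₀ η τ hτp m a Λ s Φ) - θ * (c₀ * ∑ z ∈ s, M z * fnorm τ ((Φ : Site d → 𝔸) z) ^ 2) ≤
      formE τ s (scaleFn s ω Φ) (deltaPrimeADom L U₀ η τ hτp m a Λ s (scaleFn s (fun z => (ω z)⁻¹) Φ)) := by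
  have h := formE_conj_deltaPrimeADom_ge τ hτp hτt hτs hU hT ha hω hwref hε hε' hosc Φ (η := η)
  have hdom : ∑ z ∈ s, (((η⁻¹) ^ 2 * ∑ μ : Fin d, (5 / 2 * bondRatio ω (z - e μ) μ + 1 / 2 * bondRatio ω z μ)) +
      ∑ j ∈ Finset.range (m + 1),
        (if blockMapIter L j z ∈ Λ j then a j * (ε j + ε' j + ε j * ε' j) * (((L : ℝ) ^ d)⁻¹) ^ j else 0)) * fnorm τ ((Φ : Site d → 𝔸) z) ^ 2 ≤
      θ * (c₀ * ∑ z ∈ s, M z * fnorm τ ((Φ : Site d → 𝔸) z) ^ 2) := by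
    rw [Finset.mul_sum, Finset.mul_sum]
    refine Finset.sum_le_sum fun z hz => ?_
    rw [← mul_assoc, ← mul_assoc]
    exact mul_le_mul_of_nonneg_right (hJ z hz) (sq_nonneg _)
  linarith

end Assembly

/-! ## §2  `G′(U₀)` from a displayed level-weighted coercivity and a dominated weight -/

section Decay

variable (L : ℕ) (U₀ : Site d → Fin d → 𝔸ˣ) (η : ℝ) (τ : 𝔸 →ₗ[ℂ] ℂ) [FiniteDimensional ℝ 𝔸]
  (hτp : ∀ a : 𝔸, a ≠ 0 → 0 < (τ (star a * a)).re) (m : ℕ) (a : ℕ → ℝ) (Λ : ℕ → Finset (Site d)) (s : Finset (Site d))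

/-- ★★★ **[B9] THM 3.1's (3.42), n = 0 SHAPE, FOR THE GENUINE `G′(U₀)` AT THE `ℤᵈ` CARRIER, BY AGMON'S METHOD.**  `L ≥ 1`; `U₀` unitary with unitary averaged
transporters below level `m`; `a ≥ 0`; `0 < d`, `η ≠ 0`; `τ` tracial Hermitian faithful on the finite-dimensional fibre; a DISPLAYED level-weighted coercivity
`c₀·Σ_{z∈Ω₀} M_z|Φ(z)|²_τ ≤ ⟨Φ, Ω₀Δ′_a(U₀)Ω₀Φ⟩_τ` (`c₀ > 0`, `M ≥ 0` on `Ω₀`); a weight `ω > 0` with per-level block references `ω̂_j(y) > 0` and oscillation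
bounds `ε_j, ε′_j ≥ 0` on the blocks meeting `Λ_j`, whose total defect is dominated: `J_b(z) + J_s(z) ≤ θ·c₀·M(z)` on `Ω₀`, `0 ≤ θ < 1`.  THEN for `y ∈ Ω₀` with
`ω(y) = 1` and every `x` with `M_x, M_y > 0`:  `|(G′(U₀)δ_y w)(x)|_τ ≤ |w|_τ ∕ ((1−θ)c₀·√(M_x·M_y)·ω(x))` — constants EXACTLY the displayed ones.
[cite: Balaban1985BackgroundPropagators, Thm 3.1 p.397, (3.42) p.397, (3.46) p.398, (3.24) p.394, Thm 3.11 p.416; Agmon1982, Thm 1.5 p.19] -/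
theorem fnorm_GpZd_single_le_of_levelCoercive [NeZero L] (hd : 0 < d) (hη : η ≠ 0) (hτt : ∀ a b : 𝔸, τ (a * b) = τ (b * a))
    (hτs : ∀ a : 𝔸, τ (star a) = starRingEnd ℂ (τ a)) (hU : ∀ (x : Site d) (κ : Fin d), U₀ x κ ∈ unitaryUnits 𝔸)
    (hT : ∀ j', j' < m → ∀ z y : Site d, bgT L U₀ j' z y ∈ unitaryUnits 𝔸) (ha : ∀ j, 0 ≤ a j)
    {c₀ θ : ℝ} (hc₀ : 0 < c₀) (hθ0 : 0 ≤ θ) (hθ1 : θ < 1) {M : Site d → ℝ} (hM0 : ∀ z ∈ s, 0 ≤ M z)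
    (hco : ∀ Φ : suppSub (𝔸 := 𝔸) s, c₀ * ∑ z ∈ s, M z * fnorm τ ((Φ : Site d → 𝔸) z) ^ 2 ≤ formE τ s Φ (deltaPrimeADom L U₀ η τ hτp m a Λ s Φ))
    {ω : Site d → ℝ} (hω : ∀ z, 0 < ω z) {wref : ℕ → Site d → ℝ} (hwref : ∀ j y, 0 < wref j y) {ε ε' : ℕ → ℝ} (hε : ∀ j, 0 ≤ ε j) (hε' : ∀ j, 0 ≤ ε' j)
    (hosc : ∀ j ∈ Finset.range (m + 1), ∀ y ∈ Λ j, ∀ x ∈ s, blockMapIter L j x = y → |ω x / wref j y - 1| ≤ ε j ∧ |wref j y / ω x - 1| ≤ ε' j)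
    (hJ : ∀ z ∈ s, ((η⁻¹) ^ 2 * ∑ μ : Fin d, (5 / 2 * bondRatio ω (z - e μ) μ + 1 / 2 * bondRatio ω z μ)) +
      ∑ j ∈ Finset.range (m + 1),
        (if blockMapIter L j z ∈ Λ j then a j * (ε j + ε' j + ε j * ε' j) * (((L : ℝ) ^ d)⁻¹) ^ j else 0) ≤ θ * c₀ * M z)
    {y : Site d} (hy : y ∈ s) (w : 𝔸) (hωy : ω y = 1) {x : Site d} (hMx : 0 < M x) (hMy : 0 < M y) :
    fnorm τ ((GpZd L U₀ η τ hτp m a Λ s hd hη hτt hτs hU ha (restrictSite s (single y w)) : Site d → 𝔸) x) ≤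
      fnorm τ w / ((1 - θ) * c₀ * Real.sqrt (M x * M y) * ω x) := by
  set T := deltaPrimeADom L U₀ η τ hτp m a Λ s with hT'
  have hdef := fun Φ : suppSub (𝔸 := 𝔸) s =>
    formE_conj_deltaPrimeADom_ge_of_masses τ hτp hτt hτs hU hT ha hω hwref hε hε' hosc hJ Φ (η := η)
  have hcc : ∀ Φ : suppSub (𝔸 := 𝔸) s, (1 - θ) * c₀ * ∑ z ∈ s, M z * fnorm τ ((Φ : Site d → 𝔸) z) ^ 2 ≤
      formE τ s (scaleFn s ω Φ) (T (scaleFn s (fun z => (ω z)⁻¹) Φ)) := fun Φ => conj_coercive_of_defect hco hdef Φ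
  have hc' : 0 < (1 - θ) * c₀ := mul_pos (by linarith) hc₀
  have hco' : ∀ Φ : suppSub (𝔸 := 𝔸) s, (1 - θ) * c₀ * ∑ z ∈ s, M z * fnorm τ ((Φ : Site d → 𝔸) z) ^ 2 ≤ formE τ s Φ (T Φ) := by
    intro Φ
    have hS : 0 ≤ ∑ z ∈ s, M z * fnorm τ ((Φ : Site d → 𝔸) z) ^ 2 := Finset.sum_nonneg fun z hz => mul_nonneg (hM0 z hz) (sq_nonneg _)
    have h1 : (1 - θ) * c₀ ≤ c₀ := by nlinarith
    exact (mul_le_mul_of_nonneg_right h1 hS).trans (hco Φ)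
  exact fnorm_inv_single_le_of_conj_coercive (T := T) hτp hτs hc' hM0 hω hco' hcc
    (fun h => GpZd L U₀ η τ hτp m a Λ s hd hη hτt hτs hU ha h) (fun h => deltaPrimeADom_GpZd hd hη hτt hτs hU ha h) hy w hωy hMx hMy

/-- ★★ **[B9] THM 3.1's (3.46a) SHAPE — THE `L²`-LOCAL BOUND for `G′(U₀)`**: under the same data, for `Ψ ∈ L²(Ω₀, ·)` vanishing off `B`, `ω = 1` on `B`, `ω ≥ W > 0`
and `M ≥ M_A > 0` on `A`, `M ≥ M_B > 0` on `B`:  `Σ_{z∈Ω₀∩A}|(G′(U₀)Ψ)(z)|²_τ ≤ ‖Ψ‖²_τ ∕ (((1−θ)c₀)²·M_A·M_B·W²)` — print's `B₀(Lʲη)(Lʲ′η)e^{−δ₀d(y,y′)}` with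
`B₀ = 1∕((1−θ)c₀)` at `M = (Lʲη)⁻²`, `W = e^{δ₀d}`.
[cite: Balaban1985BackgroundPropagators, Thm 3.1 p.397, (3.46) p.398, (3.24) p.394; Agmon1982, Thm 1.5 p.19] -/
theorem sq_sum_GpZd_le_of_levelCoercive [NeZero L] (hd : 0 < d) (hη : η ≠ 0) (hτt : ∀ a b : 𝔸, τ (a * b) = τ (b * a))
    (hτs : ∀ a : 𝔸, τ (star a) = starRingEnd ℂ (τ a)) (hU : ∀ (x : Site d) (κ : Fin d), U₀ x κ ∈ unitaryUnits 𝔸)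
    (hT : ∀ j', j' < m → ∀ z y : Site d, bgT L U₀ j' z y ∈ unitaryUnits 𝔸) (ha : ∀ j, 0 ≤ a j)
    {c₀ θ : ℝ} (hc₀ : 0 < c₀) (hθ0 : 0 ≤ θ) (hθ1 : θ < 1) {M : Site d → ℝ} (hM0 : ∀ z ∈ s, 0 ≤ M z)
    (hco : ∀ Φ : suppSub (𝔸 := 𝔸) s, c₀ * ∑ z ∈ s, M z * fnorm τ ((Φ : Site d → 𝔸) z) ^ 2 ≤ formE τ s Φ (deltaPrimeADom L U₀ η τ hτp m a Λ s Φ))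
    {ω : Site d → ℝ} (hω : ∀ z, 0 < ω z) {wref : ℕ → Site d → ℝ} (hwref : ∀ j y, 0 < wref j y) {ε ε' : ℕ → ℝ} (hε : ∀ j, 0 ≤ ε j) (hε' : ∀ j, 0 ≤ ε' j)
    (hosc : ∀ j ∈ Finset.range (m + 1), ∀ y ∈ Λ j, ∀ x ∈ s, blockMapIter L j x = y → |ω x / wref j y - 1| ≤ ε j ∧ |wref j y / ω x - 1| ≤ ε' j)
    (hJ : ∀ z ∈ s, ((η⁻¹) ^ 2 * ∑ μ : Fin d, (5 / 2 * bondRatio ω (z - e μ) μ + 1 / 2 * bondRatio ω z μ)) +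
      ∑ j ∈ Finset.range (m + 1),
        (if blockMapIter L j z ∈ Λ j then a j * (ε j + ε' j + ε j * ε' j) * (((L : ℝ) ^ d)⁻¹) ^ j else 0) ≤ θ * c₀ * M z)
    {mA mB W : ℝ} (hmA : 0 < mA) (hmB : 0 < mB) (hW : 0 < W) {A B : Finset (Site d)}
    (hmA' : ∀ z ∈ A, mA ≤ M z) (hmB' : ∀ z ∈ B, mB ≤ M z) (hWA : ∀ z ∈ A, W ≤ ω z) (hωB : ∀ z ∈ B, ω z = 1)
    {Ψ : suppSub (𝔸 := 𝔸) s} (hΨB : ∀ z, z ∉ B → (Ψ : Site d → 𝔸) z = 0) :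
    ∑ z ∈ s ∩ A, fnorm τ ((GpZd L U₀ η τ hτp m a Λ s hd hη hτt hτs hU ha Ψ : Site d → 𝔸) z) ^ 2 ≤
      formE τ s Ψ Ψ / (((1 - θ) * c₀) ^ 2 * mA * mB * W ^ 2) := by
  set T := deltaPrimeADom L U₀ η τ hτp m a Λ s with hT'
  have hdef := fun Φ : suppSub (𝔸 := 𝔸) s =>
    formE_conj_deltaPrimeADom_ge_of_masses τ hτp hτt hτs hU hT ha hω hwref hε hε' hosc hJ Φ (η := η)
  have hcc : ∀ Φ : suppSub (𝔸 := 𝔸) s, (1 - θ) * c₀ * ∑ z ∈ s, M z * fnorm τ ((Φ : Site d → 𝔸) z) ^ 2 ≤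
      formE τ s (scaleFn s ω Φ) (T (scaleFn s (fun z => (ω z)⁻¹) Φ)) := fun Φ => conj_coercive_of_defect hco hdef Φ
  have hc' : 0 < (1 - θ) * c₀ := mul_pos (by linarith) hc₀
  have hco' : ∀ Φ : suppSub (𝔸 := 𝔸) s, (1 - θ) * c₀ * ∑ z ∈ s, M z * fnorm τ ((Φ : Site d → 𝔸) z) ^ 2 ≤ formE τ s Φ (T Φ) := by
    intro Φ
    have hS : 0 ≤ ∑ z ∈ s, M z * fnorm τ ((Φ : Site d → 𝔸) z) ^ 2 := Finset.sum_nonneg fun z hz => mul_nonneg (hM0 z hz) (sq_nonneg _)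
    have h1 : (1 - θ) * c₀ ≤ c₀ := by nlinarith
    exact (mul_le_mul_of_nonneg_right h1 hS).trans (hco Φ)
  exact sq_sum_le_of_conj_coercive (T := T) hτp hτs hc' hmA hmB hW hM0 hω hco' hcc hmA' hmB' hWA hωB hΨB
    (deltaPrimeADom_GpZd hd hη hτt hτs hU ha Ψ)

end Decay

/-! ## §3  Exponential weights `ω = e^{κρ}` -/

section Exponential

/-- **THE BOND RATIO OF AN EXPONENTIAL WEIGHT**: `r_{e^{κρ}}(x, μ) = 2(cosh(κ(ρ(x+e_μ) − ρ(x))) − 1) ≤ 2(cosh(κℓ) − 1)` when `|ρ(x+e_μ) − ρ(x)| ≤ ℓ` (`κ ≥ 0`).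
[folklore] [cite: Balaban1985BackgroundPropagators, (3.42) p.397 (the weight `e^{−δ₀d}`); Agmon1982, Thm 1.5 p.19] -/
theorem bondRatio_exp_le {κ ℓ : ℝ} (hκ : 0 ≤ κ) {ρ : Site d → ℝ} {x : Site d} {μ : Fin d} (hℓ : |ρ (x + e μ) - ρ x| ≤ ℓ) :
    bondRatio (fun z => Real.exp (κ * ρ z)) x μ ≤ 2 * (Real.cosh (κ * ℓ) - 1) := by
  rw [bondRatio_def]
  set t : ℝ := κ * (ρ (x + e μ) - ρ x) with ht
  have hexp : Real.exp (κ * ρ (x + e μ)) = Real.exp t * Real.exp (κ * ρ x) := by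
    rw [← Real.exp_add]; congr 1; rw [ht]; ring
  have hid : (Real.exp (κ * ρ (x + e μ)) - Real.exp (κ * ρ x)) ^ 2 / (Real.exp (κ * ρ x) * Real.exp (κ * ρ (x + e μ))) =
      2 * (Real.cosh t - 1) := by
    rw [hexp, Real.cosh_eq]
    have h0 : Real.exp (κ * ρ x) ≠ 0 := (Real.exp_pos _).ne'
    have h1 : Real.exp t ≠ 0 := (Real.exp_pos _).ne'
    have h2 : Real.exp (-t) = (Real.exp t)⁻¹ := Real.exp_neg t
    rw [h2]
    field_simp
    ring
  rw [hid]
  have hcosh : Real.cosh t ≤ Real.cosh (κ * ℓ) := by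
    rw [Real.cosh_le_cosh, ht, abs_mul, abs_of_nonneg hκ]
    calc κ * |ρ (x + e μ) - ρ x| ≤ κ * ℓ := mul_le_mul_of_nonneg_left hℓ hκ
      _ ≤ |κ * ℓ| := le_abs_self _
  linarith

omit [CStarAlgebra 𝔸] in
/-- **THE BLOCK OSCILLATION OF AN EXPONENTIAL WEIGHT**: `|e^{κρ}∕e^{κρ̂} − 1| ≤ e^{κσ} − 1` when `|ρ − ρ̂| ≤ σ` (`κ ≥ 0`).
[folklore] [cite: Balaban1985BackgroundPropagators, (3.42) p.397; Agmon1982, Thm 1.5 p.19] -/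
theorem abs_exp_div_exp_sub_one_le {κ σ r rr : ℝ} (hκ : 0 ≤ κ) (h : |r - rr| ≤ σ) :
    |Real.exp (κ * r) / Real.exp (κ * rr) - 1| ≤ Real.exp (κ * σ) - 1 := by
  rw [← Real.exp_sub, show κ * r - κ * rr = κ * (r - rr) by ring]
  have hb : |κ * (r - rr)| ≤ κ * σ := by
    rw [abs_mul, abs_of_nonneg hκ]; exact mul_le_mul_of_nonneg_left h hκ
  -- `|e^u − 1| ≤ e^{|u|} − 1 ≤ e^{κσ} − 1`
  have key : ∀ u : ℝ, |Real.exp u - 1| ≤ Real.exp |u| - 1 := by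
    intro u
    rcases le_or_gt 0 u with hu | hu
    · rw [abs_of_nonneg hu, abs_of_nonneg (by linarith [Real.add_one_le_exp u])]
    · rw [abs_of_neg hu, abs_of_neg (by linarith [Real.exp_lt_one_iff.2 hu])]
      have h1 := Real.add_one_le_exp (-u)
      have h2 : Real.exp u * Real.exp (-u) = 1 := by rw [← Real.exp_add, add_neg_cancel, Real.exp_zero]
      nlinarith [Real.exp_pos u, Real.exp_pos (-u)]
  refine (key _).trans ?_
  linarith [Real.exp_le_exp.2 hb]

omit [CStarAlgebra 𝔸] in
/-- `2δ + δ² = e^{2κσ} − 1` at `δ = e^{κσ} − 1` (the oscillation constant `ε + ε′ + εε′` of FILE 2b for an exponential weight).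
[folklore] [cite: Balaban1985BackgroundPropagators, (3.42) p.397 (bookkeeping)] -/
theorem two_eps_eq (κ σ : ℝ) :
    (Real.exp (κ * σ) - 1) + (Real.exp (κ * σ) - 1) + (Real.exp (κ * σ) - 1) * (Real.exp (κ * σ) - 1) = Real.exp (2 * κ * σ) - 1 := by
  have h : Real.exp (2 * κ * σ) = Real.exp (κ * σ) * Real.exp (κ * σ) := by rw [← Real.exp_add]; ring_nf
  rw [h]; ring

variable (L : ℕ) (U₀ : Site d → Fin d → 𝔸ˣ) (η : ℝ) (τ : 𝔸 →ₗ[ℂ] ℂ) [FiniteDimensional ℝ 𝔸]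
  (hτp : ∀ a : 𝔸, a ≠ 0 → 0 < (τ (star a * a)).re) (m : ℕ) (a : ℕ → ℝ) (Λ : ℕ → Finset (Site d)) (s : Finset (Site d))

/-- ★★★ **[B9] THM 3.1's (3.42), n = 0 SHAPE, WITH AN EXPONENTIAL WEIGHT AND AN `η`-FREE WINDOW.**  Data as in `fnorm_GpZd_single_le_of_levelCoercive`; a site
function `ρ` with bond increments `|ρ(z+e_μ) − ρ(z)| ≤ ℓ` and, on the level-`j` blocks meeting `Λ_j`, radii `|ρ(x) − ρ̂_j(y)| ≤ σ_j` about references `ρ̂_j(y)`;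
`κ ≥ 0` in the WINDOW `∀ z ∈ Ω₀, 6d·η⁻²·(cosh(κℓ) − 1) + Σ_{j≤m} 𝟙[yʲ(z)∈Λ_j]·a_j(e^{2κσ_j} − 1)(Lᵈ)^{−j} ≤ θ·c₀·M(z)`.  THEN for `y ∈ Ω₀`, `M_x, M_y > 0`:
`|(G′(U₀)δ_y w)(x)|_τ ≤ e^{−κ(ρ(x) − ρ(y))}·|w|_τ ∕ ((1−θ)c₀·√(M_x M_y))`.  With print's scaling (`M = m₀(Lʲη)⁻²`, `ℓ = L^{−j}` on level-`j` bonds so that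
`η⁻²(cosh(κL^{−j}) − 1) ≈ κ²(Lʲη)⁻²∕2`, `σ_j = O(1)`, `a_j(Lᵈ)^{−j} ≈ a(Lʲη)⁻²`) the window is a condition on `κ` through `(m₀∕c₀, a∕c₀, d, θ)` only.
[cite: Balaban1985BackgroundPropagators, Thm 3.1 p.397, (3.42) p.397, (3.46) p.398, (3.24) p.394, Thm 3.11 p.416; Agmon1982, Thm 1.5 p.19] -/
theorem fnorm_GpZd_single_le_exp_of_levelCoercive [NeZero L] (hd : 0 < d) (hη : η ≠ 0) (hτt : ∀ a b : 𝔸, τ (a * b) = τ (b * a))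
    (hτs : ∀ a : 𝔸, τ (star a) = starRingEnd ℂ (τ a)) (hU : ∀ (x : Site d) (κ : Fin d), U₀ x κ ∈ unitaryUnits 𝔸)
    (hT : ∀ j', j' < m → ∀ z y : Site d, bgT L U₀ j' z y ∈ unitaryUnits 𝔸) (ha : ∀ j, 0 ≤ a j)
    {c₀ θ : ℝ} (hc₀ : 0 < c₀) (hθ0 : 0 ≤ θ) (hθ1 : θ < 1) {M : Site d → ℝ} (hM0 : ∀ z ∈ s, 0 ≤ M z)
    (hco : ∀ Φ : suppSub (𝔸 := 𝔸) s, c₀ * ∑ z ∈ s, M z * fnorm τ ((Φ : Site d → 𝔸) z) ^ 2 ≤ formE τ s Φ (deltaPrimeADom L U₀ η τ hτp m a Λ s Φ))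
    {κ ℓ : ℝ} (hκ : 0 ≤ κ) {σ : ℕ → ℝ} (hσ : ∀ j, 0 ≤ σ j) {ρ : Site d → ℝ} {rref : ℕ → Site d → ℝ}
    (hlip : ∀ (z : Site d) (μ : Fin d), |ρ (z + e μ) - ρ z| ≤ ℓ)
    (hblk : ∀ j ∈ Finset.range (m + 1), ∀ y ∈ Λ j, ∀ x ∈ s, blockMapIter L j x = y → |ρ x - rref j y| ≤ σ j)
    (hwin : ∀ z ∈ s, 6 * d * (η⁻¹) ^ 2 * (Real.cosh (κ * ℓ) - 1) +
      ∑ j ∈ Finset.range (m + 1), (if blockMapIter L j z ∈ Λ j then a j * (Real.exp (2 * κ * σ j) - 1) * (((L : ℝ) ^ d)⁻¹) ^ j else 0) ≤ θ * c₀ * M z)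
    {y : Site d} (hy : y ∈ s) (w : 𝔸) {x : Site d} (hMx : 0 < M x) (hMy : 0 < M y) :
    fnorm τ ((GpZd L U₀ η τ hτp m a Λ s hd hη hτt hτs hU ha (restrictSite s (single y w)) : Site d → 𝔸) x) ≤
      Real.exp (-(κ * (ρ x - ρ y))) / ((1 - θ) * c₀ * Real.sqrt (M x * M y)) * fnorm τ w := by
  -- the weight `ω = e^{κ(ρ − ρ(y))}`, its block references and oscillation constants
  set ρ' : Site d → ℝ := fun z => ρ z - ρ y with hρ'
  set ω : Site d → ℝ := fun z => Real.exp (κ * ρ' z) with hω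
  have hωpos : ∀ z, 0 < ω z := fun z => Real.exp_pos _
  have hωy : ω y = 1 := by simp [hω, hρ']
  set wref : ℕ → Site d → ℝ := fun j y' => Real.exp (κ * (rref j y' - ρ y)) with hwref
  have hwrefpos : ∀ j y', 0 < wref j y' := fun j y' => Real.exp_pos _
  set δ : ℕ → ℝ := fun j => Real.exp (κ * σ j) - 1 with hδ
  have hδ0 : ∀ j, 0 ≤ δ j := fun j => by
    have h1 := Real.add_one_le_exp (κ * σ j)
    have h2 : 0 ≤ κ * σ j := mul_nonneg hκ (hσ j)
    show 0 ≤ Real.exp (κ * σ j) - 1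
    linarith
  -- block oscillations of `ω`
  have hosc : ∀ j ∈ Finset.range (m + 1), ∀ y' ∈ Λ j, ∀ x' ∈ s, blockMapIter L j x' = y' →
      |ω x' / wref j y' - 1| ≤ δ j ∧ |wref j y' / ω x' - 1| ≤ δ j := by
    intro j hj y' hy' x' hx' hxy
    have hb := hblk j hj y' hy' x' hx' hxy
    constructor
    · show |Real.exp (κ * (ρ x' - ρ y)) / Real.exp (κ * (rref j y' - ρ y)) - 1| ≤ Real.exp (κ * σ j) - 1
      refine abs_exp_div_exp_sub_one_le hκ ?_
      rw [show ρ x' - ρ y - (rref j y' - ρ y) = ρ x' - rref j y' by ring]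
      exact hb
    · show |Real.exp (κ * (rref j y' - ρ y)) / Real.exp (κ * (ρ x' - ρ y)) - 1| ≤ Real.exp (κ * σ j) - 1
      refine abs_exp_div_exp_sub_one_le hκ ?_
      rw [show rref j y' - ρ y - (ρ x' - ρ y) = -(ρ x' - rref j y') by ring, abs_neg]
      exact hb
  -- the defect of `ω` is dominated through the window
  have hJ : ∀ z ∈ s, ((η⁻¹) ^ 2 * ∑ μ : Fin d, (5 / 2 * bondRatio ω (z - e μ) μ + 1 / 2 * bondRatio ω z μ)) +
      ∑ j ∈ Finset.range (m + 1),
        (if blockMapIter L j z ∈ Λ j then a j * (δ j + δ j + δ j * δ j) * (((L : ℝ) ^ d)⁻¹) ^ j else 0) ≤ θ * c₀ * M z := by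
    intro z hz
    refine le_trans (add_le_add ?_ (le_of_eq ?_)) (hwin z hz)
    · -- bond part: each ratio `≤ 2(cosh κℓ − 1)`
      have hlip' : ∀ (z : Site d) (μ : Fin d), |ρ' (z + e μ) - ρ' z| ≤ ℓ := fun z μ => by
        show |ρ (z + e μ) - ρ y - (ρ z - ρ y)| ≤ ℓ
        rw [show ρ (z + e μ) - ρ y - (ρ z - ρ y) = ρ (z + e μ) - ρ z by ring]; exact hlip z μ
      have hr : ∀ (z : Site d) (μ : Fin d), bondRatio ω z μ ≤ 2 * (Real.cosh (κ * ℓ) - 1) := fun z μ =>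
        bondRatio_exp_le hκ (hlip' z μ)
      have hsum : ∑ μ : Fin d, (5 / 2 * bondRatio ω (z - e μ) μ + 1 / 2 * bondRatio ω z μ) ≤ ∑ _μ : Fin d, 6 * (Real.cosh (κ * ℓ) - 1) := by
        refine Finset.sum_le_sum fun μ _ => ?_
        have h1 := hr (z - e μ) μ
        have h2 := hr z μ
        linarith
      rw [Finset.sum_const, Finset.card_univ, Fintype.card_fin, nsmul_eq_mul] at hsum
      calc (η⁻¹) ^ 2 * ∑ μ : Fin d, (5 / 2 * bondRatio ω (z - e μ) μ + 1 / 2 * bondRatio ω z μ)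
          ≤ (η⁻¹) ^ 2 * ((d : ℝ) * (6 * (Real.cosh (κ * ℓ) - 1))) := mul_le_mul_of_nonneg_left hsum (sq_nonneg _)
        _ = 6 * d * (η⁻¹) ^ 2 * (Real.cosh (κ * ℓ) - 1) := by ring
    · -- block part: `2δ + δ² = e^{2κσ} − 1`
      refine Finset.sum_congr rfl fun j _ => ?_
      by_cases hzj : blockMapIter L j z ∈ Λ j
      · simp only [hzj, if_true, hδ, two_eps_eq]
      · simp only [hzj, if_false]
  have hmain := fnorm_GpZd_single_le_of_levelCoercive L U₀ η τ hτp m a Λ s hd hη hτt hτs hU hT ha hc₀ hθ0 hθ1 hM0 hco hωpos hwrefpos hδ0 hδ0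
    hosc hJ hy w hωy hMx hMy
  have hK : 0 < (1 - θ) * c₀ * Real.sqrt (M x * M y) := by
    have := Real.sqrt_pos.2 (mul_pos hMx hMy)
    have : 0 < 1 - θ := by linarith
    positivity
  have hωx : ω x = Real.exp (κ * (ρ x - ρ y)) := rfl
  rw [hωx] at hmain
  rw [Real.exp_neg]
  calc fnorm τ ((GpZd L U₀ η τ hτp m a Λ s hd hη hτt hτs hU ha (restrictSite s (single y w)) : Site d → 𝔸) x)
      ≤ fnorm τ w / ((1 - θ) * c₀ * Real.sqrt (M x * M y) * Real.exp (κ * (ρ x - ρ y))) := hmain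
    _ = (Real.exp (κ * (ρ x - ρ y)))⁻¹ / ((1 - θ) * c₀ * Real.sqrt (M x * M y)) * fnorm τ w := by
        field_simp

end Exponential

end Literature.MathematicalPhysics.QuantumFieldTheory.Balaban1983to89.B9Thm31GpAgmonDecayZd

end
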